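import Literature.NumberTheory.Automorphic.UnramifiedOrbitSetLocal
import Literature.NumberTheory.Automorphic.HyperspecialUnitaryCartanAdicCompletion
import Literature.LinearAlgebra.Matrix.IntegralUnitaryConjugacyComplete
import HarnessLib

/-!
# Kottwitz's unramified orbit lemma for unitary groups over a CM field: `UnramifiedOrbitSetAE L N H` HOLDS for hermitian non-degenerate `H`
(Kottwitz, *Stable trace formula: elliptic singular terms* (1986), Prop. 7.1, Cor. 7.3; Rogawski (1990), §3.3 p. 21, §4.3 p. 44)

Topic `NumberTheory/Automorphic`; namespace `Literature.NumberTheory.Automorphic.UnitaryGroup`; THEOREMS ONLY (no definition, no instance, no named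
fact, no `sorry`).  CLOSES the repayment programme of the named fact ★ `UnitaryGroup.UnramifiedOrbitSetAE L N H` (★ `UnramifiedOrbitalUnitFactor`,
p06 census (F1)–(F3)): for every rational `γ ∈ U(H)(L⁺)` regular semisimple and all but finitely many finite places `v` of `L⁺`, every `y ∈ U(H)(L⁺_v)`
with `y γ_v y⁻¹ ∈ K_v = U(H)(𝒪_v)` lies in `K_v · Z(γ_v)` — **`unramifiedOrbitSetAE_of_hermitian (hH) (hHd) : UnramifiedOrbitSetAE L N H`** for every
hermitian `H` with `det H ≠ 0` (the kit's `H` and `Φ₃`).  The chain: ★ `IntegralConjugacyOfRegularElements` (F1, the `GL_N` lemma over a local ring) →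
★ `UnramifiedOrbitSetSplit` (split places) ∕ ★ `UnramifiedOrbitSetNonsplit` (transport at the non-split places) → ★
`IntegralUnitaryConjugacyOfRegularElements` ∕ ★ `IntegralUnitaryConjugacyComplete` (F2-b∕F2-c, p03: the unitary upgrade and the norm equation on the
commutant order `𝒪_w[γ̃]`, ★ `hnorm_of_isAdicComplete`) → ★ `UnramifiedOrbitSetLocal` (F2-d: `unramifiedOrbitSetAE_of_hnorm`) → here: the two
remaining inputs at an unramified inert place `w`, namely that the integral involution `σO` (restriction of `σ_w`) is an involution and moves some
`a ∈ 𝒪_w` by a UNIT (★ `exists_smul_sub_notMem`: `c a − a ∉ 𝔓_w` for a global `a`), and the instances `IsNoetherianRing ∕ IsAdicComplete 𝔪 ∕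
Finite (ResidueField)` of `𝒪_w = w.adicCompletionIntegers L` (a complete DVR with finite residue field — Mathlib ∕ ★ `AdicCompletionLocalField`).

* §1 `exists_isUnit_map_sub_of_isUnramifiedIn` (the unit `σO a − a`), `map_map_eq_self_of_restrict` (`σO² = 1`).
* §2 **`unramifiedOrbitSetAE_of_hermitian`**.

## References
* R. E. Kottwitz, *Stable trace formula: elliptic singular terms*, Math. Ann. 275 (1986), §7, Prop. 7.1, Cor. 7.3 [Kottwitz1986].
* J. D. Rogawski, *Automorphic Representations of Unitary Groups in Three Variables*, Ann. of Math. Stud. 123 (1990), §3.3 p. 21, §4.3 p. 44 (print)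
  [Rogawski1990].
* J.-P. Serre, *Local Fields*, GTM 67 (1979), Ch. I §7 Prop. 20; Ch. V §2 [Serre1979].
-/

set_option autoImplicit false

noncomputable section

open NumberField IsDedekindDomain Filter Polynomial
open scoped Matrix Pointwise

namespace Literature.NumberTheory.Automorphic.UnitaryGroup

open Literature.NumberTheory.QuadraticForms

section Witness

variable {F E : Type} [Field F] [NumberField F] [Field E] [NumberField E] [Algebra F E]
  [Algebra.IsQuadraticExtension F E] (c : E ≃ₐ[F] E) {v : HeightOneSpectrum (𝓞 F)} (w : PlacesOver E v)

/-- At an unramified non-split place, an integral involution `σO` of `𝒪_w` restricting `σ_w` moves some `a ∈ 𝒪_w` by a UNIT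
(`σO a − a ∈ 𝒪_wˣ`): the image of a global `a ∈ 𝓞_E` with `c a − a ∉ 𝔓_w` (★ `exists_smul_sub_notMem`). [cite: Serre1979, Ch. I §7 Prop. 20] -/
theorem exists_isUnit_map_sub_of_isUnramifiedIn (hc : c ≠ 1) (hw : c • w.1 = w.1) (hv : Algebra.IsUnramifiedIn (𝓞 E) v.asIdeal)
    (σO : w.1.adicCompletionIntegers E →+* w.1.adicCompletionIntegers E)
    (hσO : ∀ x : w.1.adicCompletionIntegers E, ((σO x : w.1.adicCompletionIntegers E) : w.1.adicCompletion E) =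
      galAdicCompletionMap (L := E) c hw x) :
    ∃ a : w.1.adicCompletionIntegers E, IsUnit (σO a - a) := by
  obtain ⟨a, ha⟩ := exists_smul_sub_notMem c w hc hw hv
  have hcoe : ∀ r : 𝓞 E, algebraMap (𝓞 E) (w.1.adicCompletion E) r = ((r : E) : w.1.adicCompletion E) := fun r => by
    rw [IsScalarTower.algebraMap_apply (𝓞 E) E (w.1.adicCompletion E), HeightOneSpectrum.algebraMap_adicCompletion]
    rfl
  let xa : w.1.adicCompletionIntegers E := ⟨((a : E) : w.1.adicCompletion E), HeightOneSpectrum.coe_mem_adicCompletionIntegers w.1 a⟩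
  have hdiff : ((σO xa - xa : w.1.adicCompletionIntegers E) : w.1.adicCompletion E) = algebraMap (𝓞 E) (w.1.adicCompletion E) (c • a - a) := by
    rw [map_sub, hcoe, hcoe, RingOfIntegers.coe_algEquiv_smul, ← galAdicCompletionMap_coe_algEquiv (σ := c) (h := hw)]
    change ((σO xa : w.1.adicCompletionIntegers E) : w.1.adicCompletion E) - (xa : w.1.adicCompletion E) = _
    rw [hσO]
  have hv1 : Valued.v (((σO xa - xa : w.1.adicCompletionIntegers E) : w.1.adicCompletion E)) = 1 := by
    rw [hdiff]
    exact valued_algebraMap_eq_one (K := E) (v := w.1) ha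
  have hne : (((σO xa - xa : w.1.adicCompletionIntegers E) : w.1.adicCompletion E)) ≠ 0 := by
    intro h0
    rw [h0, map_zero] at hv1
    exact zero_ne_one hv1
  refine ⟨xa, isUnit_iff_exists_inv.2 ⟨⟨((σO xa - xa : w.1.adicCompletionIntegers E) : w.1.adicCompletion E)⁻¹, ?_⟩, Subtype.ext ?_⟩⟩
  · rw [HeightOneSpectrum.mem_adicCompletionIntegers, map_inv₀, hv1, inv_one]
  · exact mul_inv_cancel₀ hne

/-- An integral ring endomorphism `σO` of `𝒪_w` restricting `σ_w` is an involution (`σ_w² = 1`, ★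
`galAdicCompletionMap_galAdicCompletionMap_of_smul_eq`). [cite: CasselsFrohlichANT1967, Ch. VII §1.1] -/
theorem map_map_eq_self_of_restrict (hc : c ≠ 1) (hw : c • w.1 = w.1)
    (σO : w.1.adicCompletionIntegers E →+* w.1.adicCompletionIntegers E)
    (hσO : ∀ x : w.1.adicCompletionIntegers E, ((σO x : w.1.adicCompletionIntegers E) : w.1.adicCompletion E) =
      galAdicCompletionMap (L := E) c hw x) (x : w.1.adicCompletionIntegers E) : σO (σO x) = x :=
  Subtype.ext (by rw [hσO, hσO]; exact galAdicCompletionMap_galAdicCompletionMap_of_smul_eq c w hc hw x)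

end Witness

section CM

variable (L : Type) [Field L] [NumberField L] [IsCMField L] (N : ℕ) (H : Matrix (Fin N) (Fin N) L)

/-- **`UnramifiedOrbitSetAE L N H` HOLDS for hermitian `H` with `det H ≠ 0`** — Kottwitz's unramified orbit lemma [Prop. 7.1 ∕ Cor. 7.3] for the
unitary groups `U(H)` over a CM field: for every regular semisimple rational `γ ∈ U(H)(L⁺)`, for all but finitely many finite places `v` of `L⁺`,
`{y ∈ U(H)(L⁺_v) ∣ y γ_v y⁻¹ ∈ U(H)(𝒪_v)} = U(H)(𝒪_v) · Z(γ_v)` (★ `unramifiedOrbitSetAE_of_hnorm` with the norm equation discharged by ★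
`hnorm_of_isAdicComplete` over the complete DVR `𝒪_w` with finite residue field, §1 supplying the involution and the unit `σO a − a`).  The named
fact of ★ `UnramifiedOrbitalUnitFactor` is thereby a THEOREM at the kit's forms. [cite: Kottwitz1986, Prop. 7.1; Cor. 7.3]
[cite: Rogawski1990, §3.3 p. 21; §4.3 p. 44] -/
theorem unramifiedOrbitSetAE_of_hermitian (hH : (H.map (cmConjRingHom L))ᵀ = H) (hHd : H.det ≠ 0) : UnramifiedOrbitSetAE L N H := by
  refine unramifiedOrbitSetAE_of_hnorm L N H hH hHd fun v w hw hv σO hσO Jt _ hJt hJtdet γt hγtU hsep => ?_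
  obtain ⟨a, ha⟩ := exists_isUnit_map_sub_of_isUnramifiedIn (IsCMField.complexConj L) w (IsCMField.complexConj_ne_one L) hw hv σO hσO
  exact Literature.LinearAlgebra.Matrix.hnorm_of_isAdicComplete σO
    (map_map_eq_self_of_restrict (IsCMField.complexConj L) w (IsCMField.complexConj_ne_one L) hw σO hσO) ha hJt hJtdet hγtU hsep

end CM

end Literature.NumberTheory.Automorphic.UnitaryGroup

end
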